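import Literature.NumberTheory.LFunctions.Zhang2022.RepairRplus
import Literature.NumberTheory.LFunctions.Zhang2022.ObjectiveTwinEllFrameK0
import Literature.NumberTheory.LFunctions.Zhang2022.EllRegimeK0Plane
import Literature.NumberTheory.LFunctions.Zhang2022.EllFirstOrderExpansion
import Literature.NumberTheory.LFunctions.Zhang2022.EllRegimeLambdaPinned
import HarnessLib

/-!
# Zhang (2022), programme F-S3 §E (cell landau-siegel, barrier extension, stub S-E-bell-1): INTAKE of the §B word
# KILL(B-ell) —
# the declared class `D_ell` (ℓ-decoupled designs at Zhang's detector, `P = D^A`) as the list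
# `bellWord = [familyBellOnePiece, familyBellK0Plane, familyBellFirstOrder, familyBellCSEdge, familyBellSubcritical]`,
# ONE design family per STATUS of the word — (I) main order DECIDED BY THEOREM · (I′) `K₀` plane at first order
# DECIDED (kernel) in DERIVATION currency · (II)/(II-CS) all of `D_ell` at first order GIVEN B-AH|_U ∧ dict-1 (TIER 1,
# positivity resp. Cauchy–Schwarz currency, CONDITIONAL, premises displayed) · (III′) ELL-E DECIDED «not realisable»
# — and their union `familyBell`; `bellWord_decided` (kind INTAKE: list + verbatim text + flags)

## The word (C1 — the director's sentence, riders, qualifiers and the certificate's §1, VERBATIM)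

**THE WORD, §B-ell — KILL(B-ell) INSIDE D_ell, OF RECORD at 2026-08-27T00:20:49Z** (director-frontier g6, HOME/INBOX.md
2026-08-27T00:20:49Z; TRIGGER ls-lead g2 00:19:45Z, lead custody check = NO OBJECTION), spoken as the writer's §1 HEAD
of B-ell/KILL-draft.md v0.7.4 sha16 db6e87526be7dca7 (= KILL-CERT(B-ell) v1 5625bef2660f98d2 §1 outside dated brackets) VERBATIM:

> «KILL(B-ell) INSIDE D_ell — 0 CANDIDATES; NO NUMBER LOAD-BEARING; TIER 1 (all of D_ell, first order in 1/A) = kernel implication p470105 GIVEN hQ = B-AH∣_U (premise NAMED, not proved; ∪ U_II on the reflected piece of two-sided members per RIDER R1) ∧ hexp (E-022, derivation-reviewed in scope on formula I; hexp_II = D-ELL-1c-II OWED, RIDER R2); TIER 2 (K₀ plane) = DERIVED (theory-reviewed) ∧ KERNEL on the model side (p472567) ∧ two-lineage, REF-B2-EXACT (P4 DISCHARGED 00:13:28Z); doors (α′) and (α) CLOSED at first order inside D_ell (theory (δ3) + LIST-U review); what remains is ¬B-AH = E-014, the common §B premise, a §D/§E object; NO 8-h extension asked»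

WITH RIDER R1 VERBATIM:

> «— on LIST U = U1–U8, the formula-I list (one-piece members and the direct piece of every member); for the reflected (formula-II) piece of the two-sided tie/CS members the input list U_II and the expansion hexp_II ARE D-ELL-1c-II (OWED in-programme derivation, deriv-1 g2 ≤ 05:00Z; theory re-reads (α)/(α′) on it on landing) — TIER 1 covers those members as the kernel-implication schema p470105 GIVEN B-AH|_{U ∪ U_II} ∧ hexp_II; an S/M derivation owed, displayed, neither an XL input nor a number.»

and RIDER R2 (D-ELL-1c-II NAMED OWED: structure ≤ 02:30Z, v0 ≤ 05:00Z).  STAMPS (the director's line): (i) writer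
ls-Bell-plan g1 READY-FOR-WORD 00:18:52Z (files of record DESIGN-MAP-ell v1.0.2 a8db7ab6707c426f, EDLIST v1.16
595cf63675886cdd, PLAN v1 762abd448ed15e71, PAIRS-PENDING f376f37de41aed25); (ii) REF-B2 = ls-B-ref-2 g1 COUNTERSIGN OF
RECORD 00:16:28Z on v0.7.3 12c0b065b52ebfd7, live v0.7.4 db6e87526be7dca7 = + R1 verbatim + P4 status words (REF-B2
confirms the sha on sight; the word does not wait on it since R1 is carried verbatim); (iii) ls-ref-num g3 WORDING
CHECK §1 PASS 00:07:55Z (every number clause = WORDING OF RECORD v1.0 c96e013db15f590e / v1.1 d85d5c8c2cb8ee19 verbatim;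
no number load-bearing; single-lineage items named so); (iv) theory (δ)(δ′)(α)(γ) 22:47:47Z · P3 DERIVED 23:53:50Z ·
LIST-U no door 00:03:26Z · (δ3)/(α′) closed at first order.  QUALIFIERS (explicit in every citation, DISPLAYED here,
decided nowhere in this file): **(a)** GIVEN B-AH∣_U (E-014, premise named not proved) ∧ hexp (E-022) — the kill is a
kernel IMPLICATION schema; it becomes premise-free only if E-014's status is settled in §D/§E; **(b)** DIRECTOR'S-OPTION
PRE-RULED for R2: if D-ELL-1c-II v0 (≤ 05:00Z) UNPINS a formula-II first-order datum, the word is SUSPENDED automatically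
for the reflected piece of the TWO-SIDED tie/CS members only (those members revert to READY-FOR-WORD pending theory's
(α)/(α′) re-read; one-piece members and direct pieces stand), erratum path det-style; **(c)** custody: TIER 2 two-lineage
REF-B2-exact of record; PAIRS-PENDING f376f37de41aed25 lifts proceed and a late (ε) event re-opens as for every family.
CONSEQUENCE OF RECORD: §B = SIX KILLED-INTO-§E (multi · len · dh · fam · det · ell); re-point «ell typers → S-E-bell-1
intake (barrier-plan g1's row)» — this file.  SCOPE SENTENCE (verbatim): «The programme SEARCHES and TYPES; six KILL
words say the scanned design classes contain no first-order repair of the §18 margin under the named premises; no claim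
about Landau–Siegel zeros, Theorems 1–2 of arXiv:2211.02515 or a repaired Margin232 follows until a kernel theorem says
so.»

Certificate OF RECORD: **KILL-CERT(B-ell) v1 = B-ell/KILL-draft.md v0.8 sha16 5625bef2660f98d2** (ls-Bell-plan g1
00:24:48Z §E HANDOVER; byte copy B-ell/plan-record/KILL-CERT-B-ell-v1-5625bef2660f98d2.md; = the countersigned and spoken
v0.7.4 db6e87526be7dca7 byte-for-byte outside dated brackets — the §1 WORD-OF-RECORD stamp block and one dated ERRATUM
bracket on the (III) context row; REF-B2 «v0.7.4 CONFIRMED» 00:21:42Z): §1 = file lines 4–20 of the certificate (the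
extracted §1 block has sha16 39dfb3109956c262 and is quoted below); the CLASS the §E must cover = its §2 «class D_ell»
VERBATIM (byte-identical to v0.7.2–v0.7.4; REF-B2-audited items n1–n10 printed there) — rendered in this file as the
dispatch table + the EMBEDDING paragraph below.
Pre-word →ref drafts of this file: HOME/ls-Bell-typer-2/RepairIntakeBell-draft-v2.lean (INBOX 00:10:56Z / 00:14:23Z).
NOTE ON NAMES: the declaration names and kit job ids occurring inside the quotation are the WORD'S TEXT; the decls this
file USES are cited again, by name, in the dispatch table and in the Lean below.  ONE TYPOGRAPHICAL ESCAPE (declared):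
the single byte pair «slash, hyphen-minus» of §1 (in «D1C-A⟨slash⟩⟨hyphen⟩B numerics», the DIRECTOR´S OPTION paragraph)
is rendered with U+2010 HYPHEN after the slash, because that pair opens a nested comment in Lean; nothing else differs
from the bytes of record (whitespace-normalised comparison otherwise exact).  §1 verbatim (heading line, then the body):

> ## 1 · The word (COUNTERSIGNED FORM v0.7.4 = v0.7 with status words updated (v0.7.1: theory P3; v0.7.2: theory LIST-U review, REACH 25/25, §2 fixed-design clause; v0.7.3: ref-num WORDING CHECK PASS + v1.1 REACH sentence verbatim; v0.7.4: REF-B2 COUNTERSIGN 00:16:28Z + RIDER R1 verbatim + P4 DISCHARGED) — every number clause = ls-ref-num WORDING OF RECORD v1.0 c96e013db15f590e / v1.1 d85d5c8c2cb8ee19 (one lift: REACH l.7342; all other sentences byte-identical) verbatim with its AUDIT-LEDGER row; status words in CAPS; nothing here is proved by a number)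
>
> **WORD OF RECORD — director-frontier g6, 2026-08-27T00:20:49Z (INBOX; bears_on F-S3 §B-ell · §B close-by-census):** THE WORD = «KILL(B-ell) INSIDE D_ell — 0 CANDIDATES; NO NUMBER LOAD-BEARING; TIER 1 (all of D_ell, first order in 1/A) = kernel implication p470105 GIVEN hQ = B-AH∣_U (premise NAMED, not proved; ∪ U_II on the reflected piece of two-sided members per RIDER R1) ∧ hexp (E-022, derivation-reviewed in scope on formula I; hexp_II = D-ELL-1c-II OWED, RIDER R2); TIER 2 (K₀ plane) = DERIVED (theory-reviewed) ∧ KERNEL on the model side (p472567) ∧ two-lineage, REF-B2-EXACT (P4 DISCHARGED 00:13:28Z); doors (α′) and (α) CLOSED at first order inside D_ell (theory (δ3) + LIST-U review); what remains is ¬B-AH = E-014, the common §B premise, a §D/§E object; NO 8-h extension asked» — spoken VERBATIM as this §1´s HEAD summary (the READY-FOR-WORD text), WITH RIDER R1 VERBATIM («— on LIST U = U1–U8, the formula-I list (one-piece members and the direct piece of every member); for the reflected (formula-II) piece of the two-sided tie/CS members the input list U_II and the expansion hexp_II ARE D-ELL-1c-II (OWED in-programme derivation, deriv-1 g2 ≤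 05:00Z; theory re-reads (α)/(α′) on it on landing) — TIER 1 covers those members as the kernel-implication schema p470105 GIVEN B-AH|_{U ∪ U_II} ∧ hexp_II; an S/M derivation owed, displayed, neither an XL input nor a number.») and RIDER R2 (D-ELL-1c-II NAMED OWED: structure ≤ 02:30Z, v0 ≤ 05:00Z). STAMPS (director): (i) writer READY-FOR-WORD 00:18:52Z; (ii) REF-B2 g1 COUNTERSIGN OF RECORD 00:16:28Z on v0.7.3 12c0b065b52ebfd7, live v0.7.4 = + R1 verbatim + P4 status words, «v0.7.4 db6e87526be7dca7 CONFIRMED» 00:21:42Z (unconditional); (iii) ls-ref-num g3 WORDING CHECK §1 PASS 00:07:55Z (every number clause = WORDING OF RECORD v1.0 c96e013db15f590e / v1.1 d85d5c8c2cb8ee19 verbatim; no number load-bearing; single-lineage items named so); (iv) theory (δ)(δ′)(α)(γ) 22:47:47Z · P3 DERIVED 23:53:50Z · LIST-U no door 00:03:26Z · (δ3)/(α′) closed at first order. QUALIFIERS (director; explicit in every citation): (a) GIVEN B-AH∣_U (E-014, premise named not proved) ∧ hexp (E-022) — the kill is a kernel IMPLICATION schema; it becomes premise-free only if E-014´s status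 is settled in §D/§E; (b) DIRECTOR´S-OPTION PRE-RULED for R2: if D-ELL-1c-II v0 (≤ 05:00Z) UNPINS a formula-II first-order datum, the word is SUSPENDED automatically for the reflected piece of the TWO-SIDED tie/CS members only (those members revert to READY-FOR-WORD pending theory´s (α)/(α′) re-read; one-piece members and direct pieces stand), erratum path det-style, no new trigger needed — deriv-1 g2 / theory post «D-ELL-1c-II: pinned | unpinned <datum>» and the director re-says within the hour; (c) custody: TIER 2 two-lineage REF-B2-exact of record; PAIRS-PENDING f376f37de41aed25 lifts proceed and a late (ε) event re-opens as for every family. CONSEQUENCE OF RECORD (director): §B = SIX KILLED-INTO-§E (multi · len · dh · fam · det · ell) / ZERO LIVE at 2026-08-27T00:20:49Z — the 08:10:06Z 08-27 keep/kill checkpoint is DISCHARGED EARLY; no §B extension is open. «What this says and does not say: inside the six enlarged design classes as typed and scanned, at first order, with the named premises, the programme found NO repair of the §18 main-order contradiction (E-105 schema); the common premise ¬B-AH = E-014 and the owed derivations (D-ELL-1c-II, E-102 discharge) are now THE objects — §D/§E work, not §B.» SCOPE SENTENCE (director, verbatim): «The programme SEARCHES and TYPES; six KILL words say the scanned design classes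 contain no first-order repair of the §18 margin under the named premises; no claim about Landau–Siegel zeros, Theorems 1–2 of arXiv:2211.02515 or a repaired Margin232 follows until a kernel theorem says so.» RE-POINT (ls-lead g2 00:21:44Z, table of record): this seat → bundle final (this KILL-CERT v1 + DESIGN-MAP-ell v1.0.3 9e2faeae3c560404 + EDLIST v1.16 595cf63675886cdd + PAIRS-PENDING f376f37de41aed25; CLOSEOUT-ell.md ≤ 02:20Z) then §E LIAISON K_ell (class text = §2 of this sha; shape = ls-barrier-plan g1´s call; intake row S-E-bell-1 `Zhang2022/RepairIntakeBell.lean`, typer-1 g2 / typer-2 g3); deriv-1 g2 keeps D-ELL-1c-II; REF-B2 → §E intake reader + D-ELL-1c-II referee; num bases → PAIRS-PENDING lifts then §A/§D; ell compute tranche winds down (≤ 20 core-h). THE TEXT BELOW IS v0.7.4 db6e87526be7dca7 UNCHANGED except the dated brackets named in the title.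
>
> «KILL(B-ell) INSIDE D_ell (§2) — sheets B ∈ {0.51, 2.5·10⁻⁴A, 0}; cap x ∈ {0, 1} with the KILL quantified over the LARGER class x = 1 (conductor-natural caps) ⊃ the x = 0 class (P-sharp caps), a KEEP requiring admissibility at x = 0 (theory (α) 22:47:47Z: caps decided by origin; rows whose reading differs between the sheets are flagged «x-sensitive (derivation S: D-explicit (14.2)/(15.2))»); t₀-regimes C ∈ {0 (printed-frame rows), 2B (T-room rows)} read per sheet via `EllRegime.EllDictFirstOrderLamC` (p462342), never mixed across a row (theory (γ)):
>
> HEAD. No admissible design d ∈ D_ell is a candidate: at MAIN order every one-piece wall-vanishing design is ≥ 0 BY THEOREM and the tie/PPE designs close only on bounded scale-free windows located by two-lineage numerics; at FIRST order in 1/A — the declared order of the family's objective — the dictionary is PARAMETER-FREE under (A) (theory (δ2), DERIVATION-desk) and no design closes on the model-admissible set 𝓜: TIER 1 (all of D_ell) is the KERNEL IMPLICATION `EllRegime.modelConsistentOn_of_expansion` / `not_closesFirstOrderOn_of_expansion` (p470105) GIVEN its two displayed hypotheses — hQ = E-014 at the undressed model point (B-AH|_U; premise NAMED, not proved) and hexp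 = «dict-1 is the model's 1/A-expansion» (E-022 = derivation-reviewed IN SCOPE: D-ELL-1-K0 v0.2 DERIVED theory-reviewed and D-ELL-1c v0.1 (0.1) shape ENDORSED, theory P3 23:53:50Z; obj registry v1.55; the formula-II multi-sided part D-ELL-1c-II is in derivation, deriv-1 g2, not word-critical); TIER 2 (the K₀ plane) is DERIVED (THEORY-REVIEWED, P3 23:53:50Z on D-ELL-1-K0 v0.2 b4b60c88d242532b) ∧ KERNEL on the model side (p472567, p473881, p470344) ∧ two-lineage in its numbers ∧ REF-B2-EXACT (P4 matrix discharge DONE 00:13:28Z: HOME/ls-B-ref-2/K0-PLANE-EXACT.md be5b4cbe44d77b31, a third code-disjoint exact path in ℚ(i)[π,π⁻¹] reproducing p472567´s G₀/G₁/G₂/gain and Tables A/B/C symbol by symbol) — NO pending item on (I). 0 CANDIDATES. NO NUMBER IS LOAD-BEARING.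
>
> (I) ONE-PIECE WALL-VANISHING DESIGNS = the K₀ PLANE. Class: K₀ ∩ {u(1) = 0} = {u ∈ ℂ³ : Σ_j u_j = 0} of `expComb k u` (EllRegimeStatements), = the COMPLEX PLANE span{e₁ = k₁+k₂, e₂ = k₂+k₃} with ι ∈ ℂ² free (e₁ − e₂ = k₁ − k₃; K₀-POS-001…003 = the rows e₁−e₂, e₁, e₂; REF-B2 r-plane 21:18:07Z), and every one-piece wall-vanishing profile `EllRegime.OnePieceWV` at any A. MAIN ORDER: «no» BY THEOREM — in the physical frame ℓ(P)·shrink = log P/L_Δ = 1 − 1/(2A+1) ∈ (0,1) (`IsEllRegimeP.frame_bounds`) the main term is `EllRegime.mainTerm_frame_nonneg` (p465723 `Zhang2022/ObjectiveTwinEllFrame.lean`; `onePieceWV_expComb`, `mainTerm_frame_nonneg_expComb` p466709), as a PSD statement on the plane that is SINGULAR along u* = k₁+2k₂+k₃ (no cushion there); REF-B2 exact-cubic reviewer twin 20:07:03Z (F_{1−η}/π = 32η−16η²+64η³ / 8η−40η²+72η³ / 8η+56η²+40η³ > 0). Hence a one-piece design closes only through a NEGATIVE FIRST-ORDER DICTIONARY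 TERM (`EllRegime.dict_neg_of_hnegK0(C)` / `dict_neg_of_hnegProfile`), i.e. the first-order 2×2 Hermitian value on the plane decides: «H(λ, c′) ⪰ 0 on 𝓜» ⟺ every plane design ≥ 0 (`EllRegime.herm2_forall_nonneg_iff_psd`, `herm2_psd_iff_trace_det`; decisiveness `exists_not_modelConsistentOn_plane_of_not_psd`). FIRST ORDER — DERIVED (THEORY-REVIEWED) ∧ KERNEL (model side) ∧ TWO-LINEAGE ∧ REF-B2-EXACT (P4 DISCHARGED 00:13:28Z, K0-PLANE-EXACT.md be5b4cbe44d77b31): on K₀ the 1/A-coefficient is π²c′·D(u) − πτ₀·Φ(u) + λ·G₁(u) with D = (192,176,48), Φ = (16,4,4), G₁ = −(128,32,32)π on (e₁−e₂, e₁, e₂) (D-ELL-1-K0 v0.2 b4b60c88d242532b = v0.1 c639fc46be0504c8 + §9 D1(i)(ii) closed on the page, numbers unchanged; deriv-1; THEORY-REVIEWED, P3 23:53:50Z: dipole rules (R1)–(R3), per-residue phase (R4), D1(i)(ii) ✓, K₀ first-order word «no» ENDORSED ∀ τ₀ ≥ 0, c′_ar ≥ 0, λ ≤ λ_model); as matrices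 in (e₁,e₂): G₂ = π²[[176,16],[16,48]] ≻ 0 (detuning RAISES), G₁ = −32πS ⪯ 0 with S = [[1,−1],[−1,1]] (dipole raises for λ ≤ 0; ZERO along u*; Im-cross(M¹) = 0, deriv-1 23:10:55Z / num-2 j260872 exact), gain A·Φ → 4π(1+τ₀)S = KERNEL (`EllRegime.tendsto_A_mul_phiLimC_plane`, `gainForm_eq`, rows `tendsto_A_mul_phiLimC_k13/k12/k23` → (16,4,4)π(1+τ₀), `…_uStar` → 0, exact finite-A form `A_mul_phiLimC_plane`; p473881 `Zhang2022/ObjectiveTwinEllK0Gain.lean`, obj-eng-3 g3; remainder bound p474416 ACCEPTED, |A·φ − 4π(1+2C)|a−b|²| ≤ 631(C+1)ε(|a|²+|b|²)) ⇒ Φ is a theorem; D and G₁ are DERIVED THEORY-REVIEWED (P3) and two-lineage AS VALUES (Table B/C cells of l.7311, l.7315, l.7320; D also j257567 × REF-B2 FD — deriv-1 g2 23:56:55Z). Admissible data: detuning floor c′ ≥ c′_det(τ₀) + c′_ar, c′_det = (1+τ₀)/(2π) (Lemma 2.3 admissibility), c′_ar ≥ 0 and → 0 under (A) (E-020; theory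 (δ2)); dipole parameter λ ONE-SIDED AND PINNED under (A): λ → 0⁻, |λ| ≲ c·loglog𝓛/log𝓛 (theory (δ2) 22:47:47Z, DERIVATION-desk, two routes: ν = 1∗χ ≥ 0 ⇒ λ < 0; Hadamard consistency) — independently capped by the theorem-shape box −½ − η ≤ λ ≤ C₀/log D (D-ELL-1-K0 §6.1: Hadamard + explicit DH `BGTZ2025.corollary11` + explicit N(T,χ); typed `EllRegime.EllLambdaBox η C₀`, p471750 `Zhang2022/EllRegimeLambdaBox.lean`, typer-1 g2; the (6.2) row `EllLambdaOneSided 1.7171` = theory's λ-box of record [−o(1), λ_model], λ_model·log D ≤ −1.7171 — DERIVATION-grade since P3 23:53:50Z; every K₀ statement needs only the weak one-sided form); shift vector b = (1, 2, 3) − c′α𝓛·(5, −2, 3) of Zhang (2.13) FIXED (ruling n8, 22:44Z; lattice-tied/re-centred shifts are the exit «shift redesign», not members — and deriv-1 (P2) 23:05:16Z: the lattice-tied u* is first-order ZERO and SECOND-order POSITIVE, +4(1+τ₀)²π·‖g‖²/2 per A²). THE KERNEL SENTENCE (model side): `EllRegime.modelConsistentOn_k0Plane` (p472567 `Zhang2022/EllRegimeK0Plane.lean`,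 commit 841fa5b24cd2, typer-2 g2): ∀ τ₀ ≥ 0, ∀ l₁, ∀ ι ∈ ℂ², `ModelConsistentOn (Icc l₁ 0 ×ˢ Ici ((1+τ₀)/(2π))) 0 G₀ G₁ G₂` with G₀ = −4πτ₀S, G₁ = −32πS, G₂ = π²[[176,16],[16,48]] at ι — the one-sided λ-box × the detuning half-line ⊇ the pinned model point (0⁻, c′_det(τ₀)) (`ModelConsistentOn.mono`, p466642); infimum over that box = π([[88,8],[8,24]] + τ₀[[84,12],[12,20]]) ≻ 0 for every τ₀ ≥ 0 (`k0Plane_inf`; monotonicity: each added piece PSD); `not_closesFirstOrderOn_k0Plane`; SHARPNESS BY THEOREM: on the symmetric box |λ| ≤ Λ at τ₀ = 0 the corner λ = +½, c′ = c′_det is PSD-not-PD with null k₁−2k₂−3k₃ (`modelConsistentOn_k0Plane_symm`, `k0Plane_sheet0_symmCorner_null`) and Λ > ½ FAILS (`not_modelConsistentOn_k0Plane_symm_of_gt_half`) — so an upper cap λ < ½ is load-bearing for STRICT first-order emptiness at τ₀ = 0 and is supplied twice over ((δ2) pinning, DERIVATION-desk; (6.1) cap C₀/log D → 0, theorem-shape,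 typed); at τ₀ > 0 the detuning's τ₀-part restores strictness even at λ = +½. Three-vector rows: `EllRegime.modelConsistentOn_table1_k13/k12/k23`, `firstOrderEmptyOn_table1`(/`_symm`), parametric `modelConsistentOn_k0row` / `k0row_inf`, margins (96+80τ₀, 88+84τ₀, 24+20τ₀)π exact (p470344 `Zhang2022/EllRegimeK0Table1.lean`, 5808ca28bafe); the per-vector rows p467549/p468036 are calibration (superseded booking, p473130). NUMBERS (calibration and twin of the derivation, ls-ref-num wording of record): Tables A (both conventions) / B / C / F_{b₀} and the WALL hard-cut column of D-ELL-1-K0 on the six principal + u* directions at six A values «two-lineage 126/126 + 48/48 + 36/36 + 101/101 (every printed Table A/B/C entry, all 7 directions, all tabulated A)» (l.7311, l.7315, l.7316, l.7320); u₄ / exact-cubic twin rows «two-lineage 48/48» (l.7315; REF-B2's F_{1−η}/π cubics are a reviewer twin, not a ref-num row); K₀ slopes dC232/dℓ, dC233/dℓ, d‖·‖²/dℓ, d(min_ι C232)/dℓ «two-lineage 328/328 as NUMBERS under the slope name map (A at design ℓ ↔ B `_at_design_ell`); the NAMES carry an open NUM-LABEL bounce until evaluator-A v1.22 relabels» (l.7317);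 plane box corners {trace, det, λ_min} v0 / v0.1 / symmetric box «two-lineage 128/128» (l.7313: λ_min/π at the four corners τ₀ = 0: 39.015 / 23.015 / 64.000 / 46.030; τ₀ = 51/25 v0.1: 79.414 / 59.521 / 149.528 / 129.638; symmetric box λ = +½: one exactly singular corner (c′_det, τ₀ = 0), the rest ≥ 21.9π) (this row is not yet in the WORDING file; ls-ref-num is asked to add its sentence — until then the clause speaks only the ledger verdict words of l.7313). STATUS WORD of (I): «no at MAIN order BY THEOREM (p465723/p466709); no at FIRST order on the K₀ plane — DERIVED (THEORY-REVIEWED, P3 23:53:50Z) ∧ KERNEL on the model side (p472567 ∀τ₀ ≥ 0; gain p473881; Table 1 p470344) ∧ two-lineage in every printed number (l.7311/l.7313/l.7315/l.7320) ∧ REF-B2-read (22:17:54Z), with the λ-cap supplied by theory (δ2)/(6.2) (DERIVATION) and by (6.1) (theorem-shape, typed p471750); E-022∣K₀ = derivation-reviewed (obj registry v1.54/v1.55); REF-B2 P4 DISCHARGED 00:13:28Z (exact third path)». Not a member: the unit-scale indefinite values F_ℓ(u) < 0 (ℓ > 1) need support to L_R > log P = the (7.2) wall = E*-len (B-len's killed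 class) — exit K₀^R, recorded, not pursued.
>
> (II) TIE+TENT / PPE DESIGNS (ell-tie-001…297, G1–G4 rows, G5 v1/v2/v2b, G6 admissible sup, the CS-edge corner family, the δ-family catalogue D(δ,k), block-C CS rows). MAIN ORDER: NOT EMPTY — the admissible σ′-deformed tie/CS class closes Zhang's CS endgame at main order on scale-free windows, located by two-lineage numerics (ls-ref-num wording of record): σ′-corner / σ′-tiny windows s = A·δ ∈ [2+8B, c₂*], 1/2000 ≤ δ ≤ 1/200 «two-lineage (A j258108/j258161 × B j259007/j259008; replication j259603/j259604)» (l.7183–l.7258, l.7288); closure for δ ≤ 1/2500 (x = 0) / δ ≤ 10⁻⁴ (x = 1), sup A ≈ 1.29·10⁴ / 1.8·10⁴ at printed/ridge k «two-lineage 1082/1082 cells, 26/26 windows, closure reading independently re-derived» (l.7286); G5 «two-lineage 96/96» per design (20:21:45Z rows); G5 v2 window statement M2 (one window [300, A_w], ratio* < 1 ∧ M ≻ 0 on [A⁺, 6000]) «the [A⁺, 6000] half two-lineage 20/20; the interior continuum «≥ 1 on [300, A_w]» and «no second window» PASS-pre B-only» (l.7308, l.7335); G6 admissible sup at every grid point (A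 ∈ {500,…,6000} × sheets) «two-lineage 5733/5733 (A j259873 × B j260201) and 1818/1818 (B j259393/j259439 × A-shadow j260086) — SCOPE: «an admissible design with these certified values EXISTS at every grid point»; sup quoted «≥»» (l.7290, l.7291); G6-B exclusion-rules head table (NOT-PD ⇒ near-kernel; ls-lead 21:03:48Z (3)(4)) «two-lineage 15654/15654 (finite head sup ≥ 1 at every grid point, all four sheets)» (l.7323, l.7330); G6-B L1 values ratio ≥ 1.1014 / 1.0864 / 1.1273 … «two-lineage 260/260 certified LOWER bounds at the frozen points» (l.7318); CS-edge corner family (z₃ = z₂ = cut = λX/2, δ = 2(1−2c), k = 29/20) re-tuned at every A: ratio* ≥ 1 iff A ≤ ≈ 9086 (main sheet), ≈ 9116 on (0.51,1)/(0,0) «two-lineage 44/44 at the 11 grid A; the bisected crossing 9085.7 is PASS-pre A-only» (l.7296); block-C CS rows, tied-A6000 anchor (C232@ι*, OBJ_CS@ι*, ratio*, ‖·‖², C233; interval [200.79, 6093.05]) «two-lineage 13/13 for this anchor» (l.7314); CS A-continuum REACH (0.51,0) [75, 23368.06]; (0.51,1) [75, 18545.05]; (0,0) [75, 21440.92]; (0,1)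 from 78.48 «two-lineage 25/25 by exact rational endpoint equality, statement TRUE on both lineages (A j260734 RAW × B j262123): the 9 chain anchors and the 16 further anchors alike» (l.7342, lifts l.7336; WORDING OF RECORD v1.1 d85d5c8c2cb8ee19; pair file PAIRAUDIT-CSreach25.txt 7971fd89d2135df0, 275/275 coefficient balls intersecting); δ-family catalogue incl. MAP block-A5 head row D(1/60, printed k) (CS interval [362.78, 7501.34] on the main sheet) «two-lineage 16044/16044» (l.7329). MAIN-ORDER EXTENT: admissible designs closing at main order were FOUND for every A ∈ [75, ≈ 2.34·10⁴] on the main sheet (the REACH chain; its top anchor sits at the δ-box edge δ = 1/4000 with k free) and no larger A was found on the searched grid — a SEARCH statement; no ledger row certifies non-existence beyond the grid (l.7286, l.7296, l.7336); every «sup»/«head» figure reads «sup ≥ <certified value at argmax>». The extent is IMMATERIAL to the word: main-order closing is not a candidate, because the family's objective is declared to first order in 1/A and — FIRST ORDER, TIER 1, ALL OF D_ell: «no at first order in 1/A GIVEN E-014 at the undressed model point (B-AH|_U)» (theory (δ3) 22:47:47Z: TIER 1 in its strongest form) — the KERNEL IMPLICATION `EllRegime.modelConsistentOn_of_expansion`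 (exact non-negativity Q_A ≥ 0 at every p ∈ 𝓜 for A ≥ A₀ — hypothesis hQ — and |Q_A − firstOrderValue(p)/A| ≤ K/A² — hypothesis hexp — ⇒ `ModelConsistentOn 𝓜 …`), `EllRegime.not_closesFirstOrderOn_of_expansion` (⇒ R(d) ∩ 𝓜 = ∅ verbatim), CS-sheet currency `EllRegime.csMargin_expansion` / `csFirstOrder_nonneg_of_exact` (p470105 `Zhang2022/EllFirstOrderExpansion.lean`, 118bbe0ba713), design-agnostic CS twin `EllRegime.csDictTablesAt_contra` / `theorem1_of_csProfiles` (p472326, typer-1 g2); typed target `EllRegime.FirstOrderEmptyOn D_ell data 𝓜` ⇐ `ModelConsistentOn 𝓜 gain G₀ G₁ G₂` (p463242 `firstOrderEmptyOn_of_modelConsistentOn`; box form `EllFirstOrderBox` p466642). READING: for every d ∈ D_ell the closing region R(d) := {(λ, c′) : OBJ₁(d; λ, c′) < 0} misses 𝓜, because dict-1 evaluated at model data is the 1/A-expansion of the model's exact non-negative form Q_A(d) = Σ w_ρ |H_d(ρ)|² ≥ 0; under (A) the data are PINNED — Box((A)) contracts at first order onto the undressed model point (λ, c′_ar) = (0⁻,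 0) + o(1) (theory (δ2): c′_ar → 0 by (A)-sparsity/DH-repulsion, λ → 0⁻), so 𝓜 ∋ that point is all that is needed and the dressed family {M_λ} of v0.3 is RETIRED from the word (λ-column of test #1 = robustness display only); hQ = E-014 restricted to deriv-1's LIST U (D-ELL-1c v0.1 §7) is DISPLAYED as the NAMED premise (RULE 18:15:52Z), never discharged by a number — THEORY LIST-U REVIEW 00:03:26Z (DESK; D-ELL-1c v0.1 §0–§4 and §7 thereby derivation-reviewed): U1 (1−β₁)L_M → 0, U3 Pólya–Vinogradov beyond D^{1/2+δ}, U5 ν-invisibility of AFE tails, U7 residue weights/phases, U8 ψ-orthogonality inside the wall = identities / unconditional / box-shrinking ✓; U2 Taylor data = identity given the data, and the data are PINNED by (δ2) ✓; U4 (short χ-sums D^c ≤ x ≤ D^{1/2+δ} in wall/kink layers) is NOT a door for D_ell: every interior layer of an A-independent piecewise-smooth profile sits at m ≍ P^{y₀} = D^{A·y₀} ≫ D^{1/2+δ} where U3 applies unconditionally (relative error √D·𝓛/P^{y₀}), and on the layer y ≤ (½+δ)/A such a profile is G(0) + G′(0)z + O(A⁻²), entering first order only through the Taylor data of L(s,χ)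 at 1 (= U2, absorbed in 𝔞 and λ) — U4 would be a door only for profiles with structure at y ≲ 1/A, which §2 excludes; U6 (Lemma 2.3 admissibility / displacement beyond mean square) is NOT a door: on designs with D(d) > 0 (all of K₀) c′_ar only ADDS π²c′_ar·D(d)/A ≥ 0, on designs with D(d) < 0 the (δ2)-sparsity pins c′_ar → 0, and a pointwise displacement law re-enters only at second order (D-ELL-2, u* row already positive) — NET: every entry of U is an identity, unconditional, or shrinks Box((A)); NO door (α) at first order inside D_ell; hexp for the tie/PPE class = D-ELL-1c v0.1 4ca035b170ec4165 (deriv-1 23:05:16Z: resummed form (0.1), (δ2) folded; theory P3 23:53:50Z: the (0.1) resummed shape dictOnePiece := 2Re(M_{b(A)} − (λ/A)M¹_{b(A)}) ENDORSED as the shape to type for E-022, label DERIVATION for the shape, per-design values per num; formula-II multi-sided part = D-ELL-1c-II, deriv-1 g2, structure ≤ 02:30Z / v0 ≤ 05:00Z, §E-intake completeness, not word-critical; its numerical twin D1C-A = ls-Bell-num-1 g3 kit «D1C-A» (a) certified §2 values / (b) A*-map, lineage B twin ls-Bell-num-2 g3 — calibration, NOT load-bearing). (δ′) ledger (theory): (i)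 ν = 1∗χ ≥ 0 — USED, signs and pins λ, works FOR the kill; (ii) DH-repulsion/sparsity — USED, sends c′_ar → 0; (iii) L′(1,χ) ≥ 1 − o(1) — main-order normaliser only; none is a one-sided input a non-negative configuration fails to match. DOORS: (α′) (an (A)-consequence INEQUALITY at order 1/A that no faithful model reproduces) is CLOSED at first order — both candidate data λ and c′_ar vanish (theory (δ3)); (α) (an identity-type member of U whose model expectation FAILS under (A)) is CLOSED at first order INSIDE D_ell by theory´s LIST-U review 00:03:26Z (no member of U is such an input for fixed, A-independent profiles); what remains under the name (α) is ¬B-AH outside U or for design classes outside §2 (A-dependent profile structure at y ≲ 1/A; E*-len supports) = E-014 itself, the common §B premise, a §D/§E object — not a B-ell design and not an extension target inside this family — on LIST U = U1–U8, the formula-I list (one-piece members and the direct piece of every member); for the reflected (formula-II) piece of the two-sided tie/CS members the input list U_II and the expansion hexp_II ARE D-ELL-1c-II (OWED in-programme derivation, deriv-1 g2 ≤ 05:00Z; theory re-reads (α)/(α′) on it on landing) — TIER 1 covers those members as the kernel-implication schema p470105 GIVEN B-AH|_{U ∪ U_II} ∧ hexp_II; an S/M derivation owed, displayed, neither an XL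 input nor a number. [RIDER R1 of REF-B2´s countersign 00:16:28Z, verbatim.]
>
> (III) CONTEXT, NOT MEMBERS: ELL-D zero-spacing-input designs are OUTSIDE D_ell — their inputs are AP-type hypotheses ⊋ ¬(A): Conrey–Iwaniec 2002 `Literature.NumberTheory.LFunctions.conreyIwaniec2002_theorem12` under `SubnormalGapsHypothesis c` (arXiv:math/0111012), Walker IJNT 2023 Thm 10 under AP(8/15) (untyped, lit r2-T22), with the unconditional/RH context rows Lagarias–Rodgers 2021 `Literature.Probability.PointProcesses.lagariasRodgers2021_theorem18_i/_ii/_iii` + `sineMimickedOn_half_one` / `not_mimicsSine_half_of_one_lt` (p463870, hypothesis-free: support ≤ 1 pair-correlation information never excludes AH), records `Literature.NumberTheory.LFunctions.buiEtAl2023_corollary2` (none below 0.6039 at positive density, RH), none below 1 − 9.23·10⁻⁷ unconditionally, i.o. 0.50895 (RH), Sono NMJ 2016 d-family close pairs λ₀ = 0.6073 under GRH (lit SH-114) **[ERRATUM 2026-08-27T00:24Z, ls-ref-1 g2 (w2) 00:20:15Z — POLARITY of these context records, no word text / no number of the word touched: the printed results are EXISTENCE statements — a POSITIVE PROPORTION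 of normalised gaps below every λ > 0.6039 on RH (`buiEtAl2023_corollary2`, BGMM23 Cor. 2 [paper:arxiv-2208.02359 p0004:L30–33]: μ_D ≤ 0.6039, distinct gaps μ_{D_d} ≤ 1.0522); a positive proportion (≥ 2·10⁻⁴²) within 1 − 9·10⁻⁷ mean spacings UNCONDITIONALLY (`zhao_small_gap_density`, ZeroGapsExplicit.lean, claim-tagged arXiv:2603.17334 Thm 2 / §6.2.1; Thm 2´s threshold 1 − 9.23·10⁻⁷ at unspecified density; refereed floor `stt_explicit_small_gaps` at 1 − 10^{−3·10¹³}); liminf of normalised gaps < 0.50895 on RH (Inoue, as quoted in SiegelZerosSmallZetaGaps.lean); read «none below …» above as «no positive-proportion record below …»: NONE of these reaches Conrey–Iwaniec´s threshold (a positive proportion below ½·(1 − 1/√log γ), `conreyIwaniec2002_theorem12` under `SubnormalGapsHypothesis c`), and support ≤ 1 pair-correlation information never excludes AH (LR21, p463870).]** — all §C/§D rows, none an E(d) of a member (E-058; lit-r2 CORR 22:10:22Z/23:02:08Z: the earlier pointer `leeRadziwill_gapUpperBound` was a phantom and is STRUCK); ELL-E (ℓ < 1 / ridge μ₃-branch)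 — «no» by `one_lt_ellOf`; the B ≤ ½ sub-sheet — «no (open row E-016 `KnifeEdge.Eq148DUniform`, XL)», a kill-by-price clause the charter allows, not first-order emptiness; ELL-B (B-θ: the tie designs with endgame POS, ι-block indefinite) — DISPOSED «no»: the POS event needs A ≤ ≈ 376 (record ε* ∈ [1.32927e-3, …] single-lineage B j255797 = L11 j251235), below the zero-model floor ≈ 920 and the (14.8) floor 1667; PLAN §1's two confirmation rows were conditional on a KEEP and were not run; K₀^R (unit-scale F_ℓ(u) < 0) — exit = E*-len; «shift redesign» (lattice-tied/re-centred b) — exit D-ELL-2 (second order), recorded POSITIVE at u* (deriv-1), not pursued.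
>
> **0 CANDIDATES / 370 DESIGN FILES + the G6 grid objects (A: 479 argmaxes; B: j259393/j259439/j261433/j261435 heads; 560 L0 objects) + the corner family + the δ-family catalogue (84) + the REACH anchors (25) EVALUATED — two-lineage wherever the wording above says so (G1 43/43, G2/G2b 198/198, G4 28/28 + v2 7112/7112, control 14/14, G3 724/724, K₀ cubics 24/24, K0-FO 66/66, σ′ 56/56 + 60/60, closure 26/26, G5 96/96, G6 5733/5733 + 1818/1818, G6-B head 15654/15654, L1 260/260, corner 44/44, tied anchor 13/13, REACH 25/25, δ-family 16044/16044, K₀ Tables 126/126 + 48/48 + 36/36 + 101/101, slopes 328/328, plane box 128/128), PASS-pre where it says so (M2 interior B-only; corner bisection 9085.7 A-only; G5 v2b 062/065; T_opt ev-02/03; K₀ core cells at A ≠ 2500 A-only; A-shadow bands; ℓ-detuning cells; corner crossings on (0.51,1)/(0,0) A-only; K0-FO Wfrozen/per-j); NO NUMBER IS LOAD-BEARING** — numbers locate the admissible windows and calibrate test #1; the word rests on (I) the kernel theorems + the theory-reviewed derivation (P3 23:53:50Z) and (II) the kernel implication p470105 + the NAMED premise B-AH|_U.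
>
> DIRECTOR'S OPTION (charter §3: one 8-h extension on ONE named lead). The writer of record RECOMMENDS THE WORD «KILL(B-ell) INSIDE D_ell» NOW, in the two-tier form above, and asks NO extension: theory (δ3) 22:47:47Z named no door (α′) («closed at first order») and «no 8-h extension on a λ-door is warranted from theory's side»; door (α) is CLOSED inside D_ell at first order by theory´s LIST-U review 00:03:26Z and what remains of it (¬B-AH = E-014 outside U / outside §2) belongs to §D/§E, not to a B-ell design search; the items still PENDING — theory review of D-ELL-1c-II when it lands (RIDER R2 of the countersign: D-ELL-1c-II is NAMED OWED in the trigger; should it unpin a formula-II first-order datum, that is a DIRECTOR´S-OPTION event of the re-booked-coefficient kind, erratum path after the word), ref-num lifts of the PASS-pre rows (M2 interior, corner bisection, REACH anchors), D1C-A/‐B numerics, evaluator-A v1.22 slope relabel, p474416 — change STATUS WORDS (PASS-pre → two-lineage; NUM-LABEL bounce → closed; derivation → derivation-reviewed for 1c-II), never the word; theory P3 (23:53:50Z) re-booked NO coefficient; should a later review (D-ELL-1c-II) re-book one (REF-B2 P4 re-booked none, 00:13:28Z), typer-2's re-instantiation recipe (HANDOFF § ls-Bell-typer-2 g2) re-proves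 the plane rows in one block per row and the word's form is unchanged unless the re-booked G₀(τ₀) loses PSD on the one-sided box — the ONE event that would convert (I) into an 8-h EXTENSION ask («K₀ plane: coefficient re-booked at the time of that line; re-run Table 1 / plane test, two lineages, ≤ 8 h»).»

**PREMISE OF RECORD for statuses (II)/(II-CS): B-AH∣_U** (registry E-014 at the undressed model point, restricted to
deriv-1's LIST U = U1–U8; ∪ U_II for the reflected piece of two-sided members, RIDER R1; NAMED, not proved) — displayed
below as the hQ-half of `FirstOrderExpansion 𝓜 data` resp. the hCS-half of `CSExactExpansion d`; the dictionary half
(hexp / hR) = registry E-022 (formula I: derivation-reviewed in scope; formula II: hexp_II = D-ELL-1c-II, OWED, RIDER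
R2).  Statuses (I), (I′), (III′) lean on no premise.

Y. Zhang, *Discrete mean estimates and the Landau–Siegel zero*, arXiv:2211.02515v1 [Zhang2022LandauSiegel] — an
unrefereed manuscript under adjudication. **WHAT THIS IS NOT: not a claim about Theorems 1–2 of arXiv:2211.02515,
about Landau–Siegel zeros, about a repaired `Margin232`, about Parity, and not a theorem «the class D_ell is
decided»: an INTAKE records the word's LIST, its TEXT verbatim and its FLAGS; every verdict term below is a landed
theorem cited by name or a displayed hypothesis. The programme SEARCHES and TYPES; no claim about Landau–Siegel
zeros, Theorems 1–2 of arXiv:2211.02515 or a repaired Margin232 until a kernel theorem says so.**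

## The class `D_ell` (KILL-draft §2) and its dispatch (this file)

Lens fixed (KILL-draft §2): the main-term form `F_ℓ = mainTermFormEll ℓ` at Zhang's detector, scales re-tuned to
`P = D^A` (`ℓ = L_R/L_Δ = 1 + 1/(2A+1+2τ₀…)`), designs = PHYSICAL data chosen after `A` (profiles on their true
supports, free coefficients `ι`, twists `k`, sheet exponent `B` (`T = D^B`), height `τ₀ = 2 log t₀/log D`),
admissibility = the printed `ν`-slab with `T`-rooms (`EllRegime.TExponentConstraints`), shift vector ZHANG-FIXED
(2.13) (ls-Bell-plan g1 22:44:45Z: `b = (1,2,3)` detuned on the ray, `c′ = c′_det(τ₀) + c′_ar`, `c′_det =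
(1+τ₀)/(2π)`, `c′_ar ≥ 0` a datum of the (A)-world), profiles `A`-independent.  Verdict currency (KILL-draft §5):
DERIVATION — the first-order dictionary dict-1 (registry E-022; D-ELL-1-K0 v0.2 b4b60c88d242532b DERIVED
theory-reviewed 23:53:50Z; D-ELL-1c v0.1 4ca035b170ec4165 shape (0.1) endorsed, LIST U reviewed «no door (α)»
00:03:26Z) read at the model-admissible SET `𝓜` of the two adversarial data `(λ, c′)`; under ls-theory's (δ2) the
dipole parameter is PINNED (`λ → 0⁻`, `EllRegime.EllLambdaPinned`, p476746) and `c′_ar → 0`, so `Box((A))`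
contracts onto the undressed model point and the dictionary is parameter-free.

| status | §2 stratum | family / constructor | class predicate (NO analytic hypothesis) | verdict displayed | decided by | flag |
|---|---|---|---|---|---|---|
| (I) main order | K₀-POS (`u ∈ span{k₁−k₃, k₁+k₂, k₂+k₃}`, `Σu_j = 0`) and EVERY one-piece wall-vanishing profile, any `A` | `familyBellOnePiece`, `BellDesign.onePiece G G′` | `EllRegime.OnePieceWV G G′` (continuous, vanishes on `[1,∞)`, `H¹` data) | at every scale record of the `P`-side regime (`A > 0`, `D ≥ 7`): `0 ≤ F_{ℓ(P)}(rescale (L_M/L_R) G)` — so such a design closes ONLY through a NEGATIVE first-order dictionary term (`onePiece_closes_needs_negative_dict`) | `EllRegime.mainTerm_frame_nonneg` (ls-obj-eng-3, p465723), `onePieceWV_expComb` (p466709) | DECIDED BY THEOREM |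
| (I′) first order, K₀ PLANE | the complex plane `span_ℂ{e₁ = k₁+k₂, e₂ = k₂+k₃}`, `ι ∈ ℂ²`, every sheet `τ₀ ≥ 0` (K₀-POS-001…003 = `e₁−e₂`, `e₁`, `e₂`) | `familyBellK0Plane`, `BellDesign.k0Plane ι₁ ι₂ τ₀ l₁` | `0 ≤ τ₀` | `ModelConsistentOn ([l₁,0] ×ˢ [c′_det(τ₀),∞)) 0 G₀(ι,τ₀) G₁(ι) G₂(ι)` with the v0.1/v0.2 atoms of record `G₀ = −4πτ₀S`, `G₁ = −32πS`, `G₂ = π²[[176,16],[16,48]]`, `S = [[1,−1],[−1,1]]` — the design's first-order value is `≥ 0` at EVERY model-admissible datum, hence it closes robustly over NO box meeting `𝓜` (`k0Plane_not_closes`) | `EllRegime.modelConsistentOn_k0Plane` (p472567; two-lineage 128/128 AUDIT-LEDGER l.7313; sharpness `not_modelConsistentOn_k0Plane_symm_of_gt_half`); convention D3 of D-ELL-1-K0 (gain folded: `gain = 0`, `G₀ = −πτ₀Φ`), the frame gain `A·φ → 4π(1+τ₀)S` being itself a KERNEL theorem (`EllRegime.tendsto_A_mul_phiLimC_plane`,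 ls-obj-eng-3 p473881, remainder p474416) and `Φ = 4S` thereby a theorem; three-vector twin `modelConsistentOn_k0row` / Table 1 (p470344) | DECIDED (kernel) — CURRENCY: derivation (the atoms `D`, `G₁` ARE dict-1∣K₀: D-ELL-1-K0 v0.2 DERIVED theory-reviewed, two-lineage as values l.7311/l.7315/l.7320) |
| (II) first order, ALL of `D_ell` (tie+tent / PPE G1–G6 / block C / CS sheet / one-piece; the reflected piece of two-sided members per RIDER R1) — TIER 1 | any design read through dict-1: first-order data `(gain, G₀, G₁, G₂)` and the model-admissible set `𝓜` | `familyBellFirstOrder`, `BellDesign.firstOrder data 𝓜` | `True` (the content is in the displayed premise) | `FirstOrderExpansion 𝓜 data → ModelConsistentOn 𝓜 data`: GIVEN (hQ) exact non-negativity `Q_A(p) ≥ 0` of the model's form at every `p ∈ 𝓜` for `A ≥ A₀` = **B-AH|_U (E-014 at the undressed model point, ∪ U_II for reflected pieces — RIDER R1; premise NAMED, not proved)** ∧ (hexp) dict-1 IS the model's `1/A`-expansion with zeroth order `0`, `|Q_A − value/A| ≤ K/A²` = **E-022 (formula I derivation-reviewed; hexp_II = D-ELL-1c-II OWED — RIDER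 R2, qualifier (b))**, the closing region misses `𝓜` (`firstOrder_not_closes`) | `EllRegime.modelConsistentOn_of_expansion` (ls-Bell-typer-2 g2, p470105) | CONDITIONAL — GIVEN B-AH|_U (∪ U_II) ∧ hexp (hexp_II OWED); currency derivation |
| (II-CS) first order, tie/CS sheet at a CS-EDGE corner — TIER 1, CS currency | the ε-window / G5–G6 / CS-edge corner designs read through dict-1's CS blocks: data `(D₀,D₁,J₀,J₁,X₀,X₁)` | `familyBellCSEdge`, `BellDesign.csEdge d` | `D₀·J₀ = X₀²` (zeroth-order CS equality: the edge) | `CSExactExpansion d → 0 ≤ D₀J₁ + D₁J₀ − 2X₀X₁`: GIVEN (hCS) EXACT Cauchy–Schwarz `X(A)² ≤ D(A)J(A)` at every `A ≥ A₀` = **B-AH (B1), NAMED not proved** ∧ (hR) bounded CS-remainder = **dict-1 (E-022)**, the first-order CS margin is `≥ 0` | `EllRegime.csFirstOrder_nonneg_of_exact` (p470105) | CONDITIONAL — GIVEN B-AH; currency derivation (CS) |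
| (III′) ELL-E | «`ℓ < 1`» designs: a scale record and a prime-window point `p` | `familyBellSubcritical`, `BellDesign.subcritical S p` | `0 < p ∧ 0 < t₀ ∧ 4π² < D ∧ 1 < p√D·t₀` | `¬ ℓ(p) < 1` | `EllScales.Scales.one_lt_ell` (p456970) | DECIDED («not realisable») |

EMBEDDING / DECLARED NARROWING (REF-E I2).  KILL-draft §2's sub-families map to constructors as follows: K₀-POS
(the three rows and the whole complex plane `span_ℂ{e₁,e₂}`, and every one-piece wall-vanishing profile) ↦
`BellDesign.onePiece` (main order, class `OnePieceWV`; `kbell_onePiece_expComb`) AND `BellDesign.k0Plane` (first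
order; `kbell_k0Plane_rows`); the tie/PPE sub-families F-R (σ′ = 0 limit), G5 v1/v2/v2b, G6 admissible sup, G2/G2b/
G4/G4b probes, F-P, block-C free profiles, the CS-edge corner family and the δ-family catalogue ↦ `BellDesign.firstOrder
(data(d), 𝓜)` (positivity sheet) resp. `BellDesign.csEdge (csData(d))` (tie/CS sheet at a CS-edge corner), where
`data(d) = (gain, G₀, G₁, G₂)(d)` resp. `csData(d) = (D₀,D₁,J₀,J₁,X₀,X₁)(d)` are dict-1's first-order coefficients OF
THE DESIGN (D-ELL-1c v0.1 (0.1) one-piece members; D-ELL-1c-II for two-sided/glued members, in derivation) —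
DECLARED: this intake evaluates `data(d)` for NO named tie/PPE member (their per-design values are «pending num
(a)(b)(d)»; a membership lemma with numeric data would be a ROW EVALUATION, filed separately), so for those
sub-families the coverage is STATEMENT-LEVEL through the displayed premise, exactly as the word's TIER 1 reads; the
`K₀` rows are covered with their derived integer data (TIER 2).  ELL-E ↦ `BellDesign.subcritical`.  Nothing in §2 is
silently narrowed; the items below are the word's own (III)/EXITS list.

NOT in `D_ell` / CONTEXT ONLY — NO constructor, NOT COVERED by `bellWord_decided` (KILL-draft §1 (III), §2, §8):
ELL-D zero-spacing-input designs (inputs `conreyIwaniec2002_theorem12` under `SubnormalGapsHypothesis`,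
Lagarias–Rodgers `lagariasRodgers2021_theorem18_*` (p463870, hypothesis-free: bandwidth-≤1 input never excludes
the ½ℤ model), Walker IJNT 2023 Thm 10 under AP(8/15) — AP-type hypotheses ⊋ ¬(A)); the `B ≤ ½` sub-sheet («no
(open row E-016 `KnifeEdge.Eq148DUniform`, XL)» — a kill-by-price clause, not first-order emptiness); the exits
`K₀^R` (coefficient mass beyond the dual length = E*-len), shift-vector redesign (lattice-tied shifts: §B-det's
axis), door (α)/(α′) (ls-theory: CLOSED at first order — (δ2) pins `λ`, `c′_ar`; LIST U reviewed, U4/U6 not doors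
for `A`-independent profiles); in-class levers L1–L16 (`Repair.not_repairable_true_need`, p428635).

## PRINTED BASIS (D-0021 keys)

technique_class: Zhang's three-piece positivity/Cauchy–Schwarz endgame (2.32)–(2.33) at his detector (shifts
(2.13), Lemma 2.3) with the mollifier/AFE lengths re-tuned to `P = D^A`, `T = D^B`, i.e. the zero-spacing scale
`α = π/log P` DECOUPLED from the printed `P = exp 𝓛⁹` [Zhang2022LandauSiegel §2 (2.6), (2.10), (2.13), (2.32)];
the ℓ-line of Conrey–Iwaniec («Spacing of zeros of Hecke L-functions and the class number problem», Acta Arith.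
103 (2002), arXiv:math/0111012) is its conditional ancestor (ELL-D, outside `D_ell`). blocks: «a re-tuned design
closes (2.32) at main order or at first order in `1/A`». because (DERIVATION currency): at main order the form
`F_{ℓ(P)}` on the rescaled one-piece profile is `≥ 0` in the physical frame `ℓ(P)·(L_M/L_R) = 1 − 1/(2A+1) < 1`
[tree: `mainTerm_frame_nonneg`], so only the first-order dictionary can close; on the `K₀` plane the first-order
`2×2` Hermitian pencil `H(λ,c′) = A·Φ + G₀ + λG₁ + c′G₂` has `−G₁ ⪰ 0`, `G₂ ≻ 0`, model corner
`π([[88,8],[8,24]] + τ₀[[84,12],[12,20]]) ≻ 0` [tree: `modelConsistentOn_k0Plane`; derivation D-ELL-1-K0 v0.2],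
and for every design a correct dict-1 evaluated at model data is the `1/A`-expansion of the model's exact
non-negative form (B-AH|_U) [tree: `modelConsistentOn_of_expansion`]. evasions_known: a zero-SPACING input of
bandwidth > 1 (ELL-D: CI02 under subnormal gaps; pair-correlation-conditional eliminations) — conditional, outside
the class; coefficient mass beyond the dual length (E*-len) — exit; none published inside `D_ell`.
scope_caveats: the word is a DERIVATION-currency statement GIVEN B-AH|_U (the undressed (A)-model expectation
identity on the list U), not an unconditional theorem about Zhang's discrete means; dict-1's per-design VALUES off
`K₀` are «pending num (a)(b)(d)»; formula-II (two-sided / glued) first-order classes = D-ELL-1c-II (deriv-1 g2, in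
progress) — tie designs' two-sided members enter (II) only through their dict-1 data when derived. status:
derivation-reviewed (ls-theory g1 P3 23:53:50Z + 00:03:26Z); no dissent on the bus.

«The programme SEARCHES and TYPES; no claim about Landau–Siegel zeros, Theorems 1–2 of arXiv:2211.02515 or a
repaired Margin232 until a kernel theorem says so.»
-/

noncomputable section

open Complex Real Set MeasureTheory
open scoped ComplexConjugate

namespace Literature.NumberTheory.LFunctions.Zhang2022

namespace Repair

open EllRegime EllScales Skeleton

/-! ### Part 1 — status (I): one-piece POS designs at MAIN ORDER, decided BY THEOREM (ls-obj-eng-3, cited by name) -/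

/-- **family «one-piece wall-vanishing profile at `P = D^A`, physical frame»** (K₀-POS and every `OnePieceWV`
profile, any `A`): Design = the profile data `(G, G′)`; class = `EllRegime.OnePieceWV G G′`; verdict = at EVERY
scale record of the `P`-side regime with `A > 0`, `D ≥ 7`, the main term `F_{ℓ(P)}(rescale (L_M/L_R) G) ≥ 0` — no
one-piece POS design closes through the main-term form. [cite: Zhang2022LandauSiegel, §2 (2.10), (2.23)–(2.25), (2.30), (2.32)] -/
def familyBellOnePiece : DesignFamily where
  Design := (ℝ → ℂ) × (ℝ → ℂ)
  InClass p := OnePieceWV p.1 p.2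
  Verdict p := ∀ (S : Scales) (A : ℝ), 0 < A → 7 ≤ S.D → S.IsEllRegimeP A →
    0 ≤ mainTermFormEll S.ellP (rescale S.shrink p.1) (rescale' S.shrink p.2)

/-- DECIDED by `EllRegime.mainTerm_frame_nonneg` (p465723). [cite: Zhang2022LandauSiegel, §2 (2.10), (2.30), (2.32)] -/
theorem familyBellOnePiece_decided : familyBellOnePiece.Decided :=
  fun _ h _ _ hA hD hS => mainTerm_frame_nonneg h hS hA hD

/-- **Reading of (I): closing needs a NEGATIVE first-order dictionary term.** For a member, at every regime record:
IF the one-profile closing inequality holds for all `|λ| ≤ Λ` THEN `(G₀ + λG₁)/A + K/A² < 0` for all `|λ| ≤ Λ`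
(`EllRegime.dict_neg_of_hneg`, p465723; registry row E-022). [cite: Zhang2022LandauSiegel, §2 (2.10), (2.30), (2.32); §8 (8.23)] -/
theorem onePiece_closes_needs_negative_dict {G G' : ℝ → ℂ} (h : familyBellOnePiece.InClass (G, G'))
    {S : Scales} {A G₀ G₁ Λ K : ℝ} (hS : S.IsEllRegimeP A) (hA : 0 < A) (hD : 7 ≤ S.D)
    (hneg : ∀ lam : ℝ, |lam| ≤ Λ →
      mainTermFormEll S.ellP (rescale S.shrink G) (rescale' S.shrink G') + (G₀ + lam * G₁) / A + K / A ^ 2 < 0)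
    {lam : ℝ} (hlam : |lam| ≤ Λ) : (G₀ + lam * G₁) / A + K / A ^ 2 < 0 :=
  dict_neg_of_hneg h hS hA hD hneg hlam

/-! ### Part 2 — status (I′): the `K₀` PLANE at FIRST ORDER, decided in the kernel (derivation currency) -/

/-- The v0.1/v0.2 first-order atoms of record on the plane `span_ℂ{e₁, e₂}` evaluated at `ι = (ι₁, ι₂)`:
`G₀(ι, τ₀) = −4πτ₀·S(ι)` (the `t₀`-phase part `−πτ₀Φ`, `Φ = 4S`). [cite: Zhang2022LandauSiegel, §2 (2.13), (2.32)] -/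
def k0G₀ (ι₁ ι₂ : ℂ) (τ₀ : ℝ) : ℝ :=
  -(4 * τ₀ * π) * Complex.normSq ι₁ + -(4 * τ₀ * π) * Complex.normSq ι₂ + 2 * (4 * τ₀ * π) * (conj ι₁ * ι₂).re

/-- `G₁(ι) = −32π·S(ι)` (the dipole part; `⪯ 0`, null along `u* = e₁ + e₂`). [cite: Zhang2022LandauSiegel, §2 (2.13), (2.32)] -/
def k0G₁ (ι₁ ι₂ : ℂ) : ℝ :=
  -(32 * π) * Complex.normSq ι₁ + -(32 * π) * Complex.normSq ι₂ + 2 * (32 * π) * (conj ι₁ * ι₂).re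

/-- `G₂(ι) = π²·[[176,16],[16,48]](ι)` (the detuning part `π²c′·D`). [cite: Zhang2022LandauSiegel, §2 (2.13), (2.32)] -/
def k0G₂ (ι₁ ι₂ : ℂ) : ℝ :=
  176 * π ^ 2 * Complex.normSq ι₁ + 48 * π ^ 2 * Complex.normSq ι₂ + 2 * (16 * π ^ 2) * (conj ι₁ * ι₂).re

/-- The model-admissible set of record on a sheet of height `τ₀`: `𝓜 = [l₁, 0] × [c′_det(τ₀), ∞)`,
`c′_det = (1+τ₀)/(2π)` (Lemma 2.3 admissibility; `λ` one-sided, under (δ2) `λ → 0⁻`; `c′_ar ≥ 0` free above the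
floor, under (δ2) `→ 0`). [cite: Zhang2022LandauSiegel, §2 Lemma 2.3, (2.13), (2.15)] -/
def k0Model (τ₀ l₁ : ℝ) : Set (ℝ × ℝ) := Icc l₁ 0 ×ˢ Ici ((1 + τ₀) / (2 * π))

/-- A `K₀`-plane design: coefficients `(ι₁, ι₂)` on `(e₁, e₂) = (k₁+k₂, k₂+k₃)`, the sheet height `τ₀`, and the
lower end `l₁` of the `λ`-range of `𝓜` displayed with the design. [cite: Zhang2022LandauSiegel, §2 (2.23)–(2.25), (2.32)] -/
structure K0PlaneDesign : Type where
  /-- coefficient on `e₁ = k₁ + k₂` -/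
  ι₁ : ℂ
  /-- coefficient on `e₂ = k₂ + k₃` -/
  ι₂ : ℂ
  /-- sheet height `τ₀ = 2 log t₀/log D` (`0` = printed frame; `4B` = `T`-room sheets) -/
  τ₀ : ℝ
  /-- lower end of the `λ`-range of the model-admissible set (any real; `−½ − o(1)` unconditional shape) -/
  l₁ : ℝ

/-- **family «`K₀` plane at first order»**: class = `0 ≤ τ₀`; verdict = the design's first-order value
`G₀ + λG₁ + c′G₂` (gain `0`) is `≥ 0` at EVERY model-admissible datum `(λ, c′) ∈ [l₁,0] × [c′_det(τ₀), ∞)`.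
[cite: Zhang2022LandauSiegel, §2 Lemma 2.3, (2.13), (2.15), (2.32)] -/
def familyBellK0Plane : DesignFamily where
  Design := K0PlaneDesign
  InClass d := 0 ≤ d.τ₀
  Verdict d := ModelConsistentOn (k0Model d.τ₀ d.l₁) 0 (k0G₀ d.ι₁ d.ι₂ d.τ₀) (k0G₁ d.ι₁ d.ι₂) (k0G₂ d.ι₁ d.ι₂)

/-- DECIDED by `EllRegime.modelConsistentOn_k0Plane` (p472567). [cite: Zhang2022LandauSiegel, §2 Lemma 2.3, (2.13), (2.32)] -/
theorem familyBellK0Plane_decided : familyBellK0Plane.Decided :=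
  fun d h => modelConsistentOn_k0Plane d.l₁ h d.ι₁ d.ι₂

/-- **Reading of (I′): no robust first-order closing on the plane.** A member closes robustly over NO admissible
box `M` containing a model datum `(λ₀, c₀)` (`l₁ ≤ λ₀ ≤ 0`, `c₀ ≥ c′_det(τ₀)`). [cite: Zhang2022LandauSiegel, §2 Lemma 2.3, (2.13), (2.32)] -/
theorem k0Plane_not_closes (d : K0PlaneDesign) (h : familyBellK0Plane.InClass d) {lam₀ c₀ : ℝ}
    {M : Set (ℝ × ℝ)} (hl : d.l₁ ≤ lam₀) (hl' : lam₀ ≤ 0) (hc₀ : (1 + d.τ₀) / (2 * π) ≤ c₀)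
    (hM : (lam₀, c₀) ∈ M) :
    ¬ ClosesFirstOrderOn M 0 (k0G₀ d.ι₁ d.ι₂ d.τ₀) (k0G₁ d.ι₁ d.ι₂) (k0G₂ d.ι₁ d.ι₂) :=
  not_closesFirstOrderOn_k0Plane h hl hl' hc₀ hM d.ι₁ d.ι₂


/-- **Reading of (I′) joined with ls-theory's (δ2)** (`EllRegime.EllLambdaPinned`, p476746: under (A) the dipole
parameter `λ(χ) → 0⁻`): GIVEN the pinning row, for every member with `l₁ < 0`, eventually along real primitive
`χ` with (A), the design closes robustly over NO box `M` containing an (A)-world datum `(λ(χ), c₀)` with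
`c₀ ≥ c′_det(τ₀)` — the `λ`-column is a robustness display, the model point decides.
[cite: Zhang2022LandauSiegel, §2 Lemma 2.3, (2.13), (2.32); §5 Lemma 5.7] -/
theorem k0Plane_not_closes_of_pinned (hpin : EllLambdaPinned) (d : K0PlaneDesign)
    (h : familyBellK0Plane.InClass d) (hl : d.l₁ < 0) :
    ForAllLarge fun D _ χ => AssumptionA D χ → ∀ (c₀ : ℝ) (M : Set (ℝ × ℝ)),
      (1 + d.τ₀) / (2 * π) ≤ c₀ → (lambdaDipole χ, c₀) ∈ M →
        ¬ ClosesFirstOrderOn M 0 (k0G₀ d.ι₁ d.ι₂ d.τ₀) (k0G₁ d.ι₁ d.ι₂) (k0G₂ d.ι₁ d.ι₂) :=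
  ((hpin.1 (-d.l₁) (neg_pos.mpr hl)).and hpin.2).mono fun _ _ χ _ _ hall hA c₀ M hc₀ hM =>
    k0Plane_not_closes d h (lam₀ := lambdaDipole χ) (by have := hall.1 hA; linarith) (hall.2 hA).le hc₀ hM

/-! ### Part 3 — status (II): ALL of `D_ell` at FIRST ORDER — TIER 1, CONDITIONAL (premises displayed) -/

/-- **The displayed premise of TIER 1** for first-order data `(gain, G₀, G₁, G₂)` on the model-admissible set
`𝓜`: at every `p ∈ 𝓜` there are `A₀ > 0`, `K` and the model's exact form `A ↦ Q_A(p)` with (hQ) `Q_A(p) ≥ 0`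
for `A ≥ A₀` — **B-AH|_U** (registry E-014 at the undressed model point, on LIST U = U1–U8 for one-piece members and
the direct piece of every member, ∪ U_II for the reflected piece of two-sided tie/CS members per RIDER R1; NAMED,
proved by no one) — and (hexp) `|Q_A(p) − value(p)/A| ≤ K/A²` — **dict-1 is the model's `1/A`-expansion** (registry
E-022: formula I derivation-reviewed in scope; hexp_II = D-ELL-1c-II OWED per RIDER R2).  Exactly the hypothesis of
`EllRegime.modelConsistentOn_of_expansion`. A DEFINITION (a displayed hypothesis shape), asserted for no data.
[cite: Zhang2022LandauSiegel, §2 Lemma 2.3, (2.13), (2.32); §8 (8.23)] -/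
def FirstOrderExpansion (𝓜 : Set (ℝ × ℝ)) (data : ℝ × ℝ × ℝ × ℝ) : Prop :=
  ∀ p ∈ 𝓜, ∃ (A₀ K : ℝ) (Q : ℝ → ℝ), 0 < A₀ ∧ (∀ A, A₀ ≤ A → 0 ≤ Q A) ∧
    ∀ A, A₀ ≤ A → |Q A - firstOrderValue data.1 data.2.1 data.2.2.1 data.2.2.2 p / A| ≤ K / A ^ 2

/-- **family «first-order reading of a design through dict-1» (TIER 1)**: Design = the data `(gain, G₀, G₁, G₂)`
with its model-admissible set `𝓜`; NO class restriction; verdict = GIVEN `FirstOrderExpansion 𝓜 data`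
(B-AH|_U ∧ dict-1, DISPLAYED), the first-order value is `≥ 0` on `𝓜` — the closing region misses `𝓜`.
[cite: Zhang2022LandauSiegel, §2 Lemma 2.3, (2.13), (2.32)] -/
def familyBellFirstOrder : DesignFamily where
  Design := (ℝ × ℝ × ℝ × ℝ) × Set (ℝ × ℝ)
  InClass _ := True
  Verdict p := FirstOrderExpansion p.2 p.1 → ModelConsistentOn p.2 p.1.1 p.1.2.1 p.1.2.2.1 p.1.2.2.2

/-- DECIDED (as a conditional) by `EllRegime.modelConsistentOn_of_expansion` (p470105).
[cite: Zhang2022LandauSiegel, §2 Lemma 2.3, (2.32)] -/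
theorem familyBellFirstOrder_decided : familyBellFirstOrder.Decided :=
  fun _ _ h => modelConsistentOn_of_expansion h

/-- **Reading of (II): the closing region misses `𝓜`.** GIVEN the displayed premise, a design closes robustly over
NO box `M` meeting `𝓜` (`EllRegime.not_closesFirstOrderOn_of_expansion`). [cite: Zhang2022LandauSiegel, §2 Lemma 2.3, (2.32)] -/
theorem firstOrder_not_closes {data : ℝ × ℝ × ℝ × ℝ} {𝓜 M : Set (ℝ × ℝ)} (h : FirstOrderExpansion 𝓜 data)
    (hmeet : (𝓜 ∩ M).Nonempty) : ¬ ClosesFirstOrderOn M data.1 data.2.1 data.2.2.1 data.2.2.2 :=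
  not_closesFirstOrderOn_of_expansion h hmeet

/-! ### Part 3b — status (II-CS): the tie/CS SHEET at first order at a CS-EDGE corner — TIER 1 in
Cauchy–Schwarz currency, CONDITIONAL (premise displayed) -/

/-- First-order CS data of a design on the tie/CS sheet: the model's three means expand as
`D(A) = D₀ + D₁/A + …`, `J(A) = J₀ + J₁/A + …`, `X(A) = X₀ + X₁/A + …` (registry E-022's CS blocks; KILL-draft §1
(II) «CS-sheet currency»). [cite: Zhang2022LandauSiegel, §2 (2.17)–(2.20), (2.32)–(2.33)] -/
structure CSEdgeDesign : Type where
  /-- zeroth-order probe mean `D₀` -/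
  D₀ : ℝ
  /-- first-order probe coefficient `D₁` -/
  D₁ : ℝ
  /-- zeroth-order `J`-mean `J₀` -/
  J₀ : ℝ
  /-- first-order `J`-coefficient `J₁` -/
  J₁ : ℝ
  /-- zeroth-order cross mean `X₀` -/
  X₀ : ℝ
  /-- first-order cross coefficient `X₁` -/
  X₁ : ℝ

/-- **The displayed premise of TIER 1 on the CS sheet**: remainders `d, j, x` with a bounded CS-remainder for
`A ≥ A₀ > 0` (hR — dict-1 in CS currency, E-022) and EXACT Cauchy–Schwarz `X(A)² ≤ D(A)·J(A)` at every `A ≥ A₀`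
(hCS — **B-AH (B1)**, NAMED, proved by no one). Exactly the hypotheses of `EllRegime.csFirstOrder_nonneg_of_exact`.
A DEFINITION, asserted for no data. [cite: Zhang2022LandauSiegel, §2 (2.18)–(2.20), (2.32)–(2.33)] -/
def CSExactExpansion (d : CSEdgeDesign) : Prop :=
  ∃ (A₀ K : ℝ) (dd j x : ℝ → ℝ), 0 < A₀ ∧
    (∀ A, A₀ ≤ A → |(d.D₀ * j A + d.D₁ * d.J₁ + dd A * d.J₀ - d.X₁ ^ 2 - 2 * d.X₀ * x A) +
        (d.D₁ * j A + dd A * d.J₁ - 2 * d.X₁ * x A) * (1 / A) + (dd A * j A - x A ^ 2) * (1 / A) ^ 2| ≤ K) ∧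
    (∀ A, A₀ ≤ A → (d.X₀ + d.X₁ * (1 / A) + x A * (1 / A) ^ 2) ^ 2 ≤
        (d.D₀ + d.D₁ * (1 / A) + dd A * (1 / A) ^ 2) * (d.J₀ + d.J₁ * (1 / A) + j A * (1 / A) ^ 2))

/-- **family «tie/CS sheet at a CS-EDGE corner, first order» (TIER 1, CS currency)**: class = the zeroth order
is a CS EQUALITY `D₀J₀ = X₀²` (the edge where the `ε`-windows of KILL-draft §1 (II) live); verdict = GIVEN
`CSExactExpansion d` (B-AH (B1) ∧ dict-1, DISPLAYED), the first-order CS margin `D₀J₁ + D₁J₀ − 2X₀X₁ ≥ 0` — the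
design does not close at first order on the CS sheet. [cite: Zhang2022LandauSiegel, §2 (2.18)–(2.20), (2.32)–(2.33)] -/
def familyBellCSEdge : DesignFamily where
  Design := CSEdgeDesign
  InClass d := d.D₀ * d.J₀ = d.X₀ ^ 2
  Verdict d := CSExactExpansion d → 0 ≤ d.D₀ * d.J₁ + d.D₁ * d.J₀ - 2 * d.X₀ * d.X₁

/-- DECIDED (as a conditional) by `EllRegime.csFirstOrder_nonneg_of_exact` (p470105).
[cite: Zhang2022LandauSiegel, §2 (2.18)–(2.20), (2.32)–(2.33)] -/
theorem familyBellCSEdge_decided : familyBellCSEdge.Decided := by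
  rintro d h0 ⟨A₀, K, dd, j, x, hA₀, hR, hCS⟩
  exact csFirstOrder_nonneg_of_exact hA₀ h0 hR hCS

/-! ### Part 4 — status (III′): ELL-E «`ℓ < 1`» is not realisable (decided) -/

/-- **family «subcritical `ℓ < 1` designs» (ELL-E)**: Design = a scale record and a prime-window point `p`; class =
`p > 0`, `t₀ > 0`, `D > 4π²`, `p√D·t₀ > 1`; verdict = `ℓ(p) = L_R/L_Δ` is NOT `< 1`.
[cite: Zhang2022LandauSiegel, §2 (2.10), (2.30)] -/
def familyBellSubcritical : DesignFamily where
  Design := Scales × ℝ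
  InClass p := 0 < p.2 ∧ 0 < p.1.t0 ∧ 4 * π ^ 2 < (p.1.D : ℝ) ∧ 1 < p.2 * Real.sqrt p.1.D * p.1.t0
  Verdict p := ¬ p.1.ell p.2 < 1

/-- DECIDED by `EllScales.Scales.one_lt_ell` (p456970). [cite: Zhang2022LandauSiegel, §2 (2.10), (2.30)] -/
theorem familyBellSubcritical_decided : familyBellSubcritical.Decided :=
  fun p h hlt => absurd (Scales.one_lt_ell p.1 h.1 h.2.1 h.2.2.1 h.2.2.2) (not_lt.mpr hlt.le)

/-! ### Part 5 — the union family `familyBell` and the word's LIST `bellWord` -/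

/-- **Designs of `D_ell` as read by this intake** (one constructor per status row): `onePiece` (I),
`k0Plane` (I′), `firstOrder` (II), `csEdge` (II-CS), `subcritical` (III′). [cite: Zhang2022LandauSiegel, §2 (2.10), (2.32)] -/
inductive BellDesign : Type
  | onePiece (G G' : ℝ → ℂ)
  | k0Plane (ι₁ ι₂ : ℂ) (τ₀ l₁ : ℝ)
  | firstOrder (data : ℝ × ℝ × ℝ × ℝ) (𝓜 : Set (ℝ × ℝ))
  | csEdge (d : CSEdgeDesign)
  | subcritical (S : Scales) (p : ℝ)

/-- Membership = the covering family's class (no analytic hypothesis). [cite: Zhang2022LandauSiegel, §2 (2.10), (2.32)] -/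
def KBell : BellDesign → Prop
  | .onePiece G G' => familyBellOnePiece.InClass (G, G')
  | .k0Plane ι₁ ι₂ τ₀ l₁ => familyBellK0Plane.InClass ⟨ι₁, ι₂, τ₀, l₁⟩
  | .firstOrder data 𝓜 => familyBellFirstOrder.InClass (data, 𝓜)
  | .csEdge d => familyBellCSEdge.InClass d
  | .subcritical S p => familyBellSubcritical.InClass (S, p)

/-- Verdict = the covering family's verdict (conditional premise displayed there). [cite: Zhang2022LandauSiegel, §2 (2.10), (2.32)] -/
def VBell : BellDesign → Prop
  | .onePiece G G' => familyBellOnePiece.Verdict (G, G')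
  | .k0Plane ι₁ ι₂ τ₀ l₁ => familyBellK0Plane.Verdict ⟨ι₁, ι₂, τ₀, l₁⟩
  | .firstOrder data 𝓜 => familyBellFirstOrder.Verdict (data, 𝓜)
  | .csEdge d => familyBellCSEdge.Verdict d
  | .subcritical S p => familyBellSubcritical.Verdict (S, p)

/-- **`D_ell` (this intake's rows) as ONE family.** [cite: Zhang2022LandauSiegel, §2 (2.10), (2.32)] -/
def familyBell : DesignFamily where
  Design := BellDesign
  InClass := KBell
  Verdict := VBell

/-- **`familyBell` is decided** — by cases from the landed terms (each row in its own currency; (II) conditional).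
[cite: Zhang2022LandauSiegel, §2 (2.10), (2.32)] -/
theorem familyBell_decided : familyBell.Decided
  | .onePiece G G', h => familyBellOnePiece_decided (G, G') h
  | .k0Plane ι₁ ι₂ τ₀ l₁, h => familyBellK0Plane_decided ⟨ι₁, ι₂, τ₀, l₁⟩ h
  | .firstOrder data 𝓜, h => familyBellFirstOrder_decided (data, 𝓜) h
  | .csEdge d, h => familyBellCSEdge_decided d h
  | .subcritical S p, h => familyBellSubcritical_decided (S, p) h

/-- **The word's LIST** (one family per status): `[familyBellOnePiece, familyBellK0Plane, familyBellFirstOrder,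
familyBellCSEdge, familyBellSubcritical]`. [cite: Zhang2022LandauSiegel, §2 (2.32)] -/
def bellWord : List DesignFamily :=
  [familyBellOnePiece, familyBellK0Plane, familyBellFirstOrder, familyBellCSEdge, familyBellSubcritical]

/-- **`bellWord` is decided** (from the landed `_decided` terms only). [cite: Zhang2022LandauSiegel, §2 (2.32)] -/
theorem bellWord_decided : ClassDecided bellWord :=
  classDecided_cons familyBellOnePiece_decided <| classDecided_cons familyBellK0Plane_decided <|
    classDecided_cons familyBellFirstOrder_decided <| classDecided_cons familyBellCSEdge_decided <|
      classDecided_cons familyBellSubcritical_decided classDecided_nil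

/-- The union family together with the list. [cite: Zhang2022LandauSiegel, §2 (2.32)] -/
theorem familyBell_bellWord_decided : ClassDecided (familyBell :: bellWord) :=
  classDecided_cons familyBell_decided bellWord_decided

/-- Membership in the list. [cite: Zhang2022LandauSiegel, §2 (2.32)] -/
theorem mem_bellWord_iff (F : DesignFamily) :
    F ∈ bellWord ↔ F = familyBellOnePiece ∨ F = familyBellK0Plane ∨ F = familyBellFirstOrder ∨
      F = familyBellCSEdge ∨ F = familyBellSubcritical := by
  simp [bellWord]

/-- **`R⁺ ++ bellWord` is decided** (R⁺ untouched). [cite: Zhang2022LandauSiegel, §2 (2.32)–(2.33)] -/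
theorem rplus_bellWord_decided : ClassDecided (Rplus ++ bellWord) :=
  classDecided_append.mpr ⟨rplus_decided, bellWord_decided⟩

/-- `R⁺ ++ [familyBell]` is decided. [cite: Zhang2022LandauSiegel, §2 (2.32)–(2.33)] -/
theorem rplus_bell_decided : ClassDecided (Rplus ++ [familyBell]) :=
  rplus_extend familyBell_decided

/-! ### Part 6 — C2 by term, C4 members, C3 slots inhabited ∧ load-bearing -/

/-- C2 (read-back): the constructors ARE the rows. [cite: Zhang2022LandauSiegel, §2 (2.32)] -/
theorem kbell_rows_iff (G G' : ℝ → ℂ) (ι₁ ι₂ : ℂ) (τ₀ l₁ : ℝ) (data : ℝ × ℝ × ℝ × ℝ) (𝓜 : Set (ℝ × ℝ))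
    (c : CSEdgeDesign) (S : Scales) (p : ℝ) :
    (KBell (.onePiece G G') ↔ OnePieceWV G G') ∧ (KBell (.k0Plane ι₁ ι₂ τ₀ l₁) ↔ 0 ≤ τ₀) ∧
      (KBell (.firstOrder data 𝓜) ↔ True) ∧ (KBell (.csEdge c) ↔ c.D₀ * c.J₀ = c.X₀ ^ 2) ∧
      (KBell (.subcritical S p) ↔ 0 < p ∧ 0 < S.t0 ∧ 4 * π ^ 2 < (S.D : ℝ) ∧ 1 < p * Real.sqrt S.D * S.t0) :=
  ⟨Iff.rfl, Iff.rfl, Iff.rfl, Iff.rfl, Iff.rfl⟩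

/-- C4 (I): the three `K₀` profiles — and every `Σ u_j = 0` combination of the AFE directions at any real shifts —
are `onePiece` members (`onePieceWV_expComb`, p466709). [cite: Zhang2022LandauSiegel, §2 (2.23)–(2.25)] -/
theorem kbell_onePiece_expComb (k : Fin 3 → ℝ) {u : Fin 3 → ℂ} (hu : ∑ j, u j = 0) :
    KBell (.onePiece (expComb k u) (expComb' k u)) :=
  onePieceWV_expComb k hu

/-- C4 (I′): the rows K₀-POS-001…003 (`e₁ − e₂ = k₁ − k₃`, `e₁ = k₁ + k₂`, `e₂ = k₂ + k₃`) on both sheets of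
record (`τ₀ = 0` printed frame, `τ₀ = 51/25` `T`-room) are `k0Plane` members, for any `l₁`.
[cite: Zhang2022LandauSiegel, §2 (2.23)–(2.25), (2.32)] -/
theorem kbell_k0Plane_rows (l₁ : ℝ) :
    KBell (.k0Plane 1 (-1) 0 l₁) ∧ KBell (.k0Plane 1 0 0 l₁) ∧ KBell (.k0Plane 0 1 0 l₁) ∧
      KBell (.k0Plane 1 (-1) (51 / 25) l₁) ∧ KBell (.k0Plane 1 0 (51 / 25) l₁) ∧
      KBell (.k0Plane 0 1 (51 / 25) l₁) := by
  refine ⟨?_, ?_, ?_, ?_, ?_, ?_⟩ <;> change (0 : ℝ) ≤ _ <;> norm_num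

/-- C4 (I′) verdict instance: the row K₀-POS-001 (`k₁ − k₃`, printed frame) is model-consistent on
`[−½, 0] × [1/(2π), ∞)`. [cite: Zhang2022LandauSiegel, §2 Lemma 2.3, (2.13), (2.32)] -/
theorem vbell_k0Plane_k13 : VBell (.k0Plane 1 (-1) 0 (-(1 / 2))) :=
  familyBell_decided (.k0Plane 1 (-1) 0 (-(1 / 2))) (by change (0 : ℝ) ≤ 0; exact le_rfl)

/-- C4 (II): every first-order datum with its model set is a `firstOrder` member (class unrestricted; the content
is the displayed premise). [cite: Zhang2022LandauSiegel, §2 (2.32)] -/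
theorem kbell_firstOrder (data : ℝ × ℝ × ℝ × ℝ) (𝓜 : Set (ℝ × ℝ)) : KBell (.firstOrder data 𝓜) := trivial

/-- C3 (II) — premise INHABITED: the `K₀`-plane data of a member satisfy `FirstOrderExpansion` on their model set
with the exact form `Q_A := value/A` (`K = 0`): model-consistent data always inhabit the premise.
[cite: Zhang2022LandauSiegel, §2 Lemma 2.3, (2.13), (2.32)] -/
theorem firstOrderExpansion_of_modelConsistentOn {𝓜 : Set (ℝ × ℝ)} {data : ℝ × ℝ × ℝ × ℝ}
    (h : ModelConsistentOn 𝓜 data.1 data.2.1 data.2.2.1 data.2.2.2) : FirstOrderExpansion 𝓜 data := by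
  intro p hp
  refine ⟨1, 0, fun A => firstOrderValue data.1 data.2.1 data.2.2.1 data.2.2.2 p / A, one_pos,
    fun A hA => div_nonneg (h p hp) (le_trans zero_le_one hA), fun A _ => ?_⟩
  simp

/-- C3 (II) — premise inhabited by a member of record: the `K₀`-plane row `k₁ − k₃` (printed frame).
[cite: Zhang2022LandauSiegel, §2 Lemma 2.3, (2.13), (2.32)] -/
theorem firstOrder_premise_inhabited :
    FirstOrderExpansion (k0Model 0 (-(1 / 2))) (0, k0G₀ 1 (-1) 0, k0G₁ 1 (-1), k0G₂ 1 (-1)) :=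
  firstOrderExpansion_of_modelConsistentOn
    (modelConsistentOn_k0Plane (τ₀ := 0) (-(1 / 2)) le_rfl 1 (-1))

/-- C3 (II) — premise LOAD-BEARING: WITHOUT it the verdict shape fails — the datum `(gain, G₀, G₁, G₂) =
(−1, 0, 0, 0)` is not model-consistent on any non-empty `𝓜` (value `−1` everywhere), e.g. on `univ`.
[cite: Zhang2022LandauSiegel, §2 (2.32)] -/
theorem firstOrder_premise_loadBearing : ¬ ModelConsistentOn (Set.univ : Set (ℝ × ℝ)) (-1) 0 0 0 := by
  intro h
  have := h (0, 0) (Set.mem_univ _)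
  norm_num [firstOrderValue] at this

/-- C3 (II) — and the unpremised verdict is FALSE as a schema: not every datum is model-consistent.
[cite: Zhang2022LandauSiegel, §2 (2.32)] -/
theorem firstOrder_unpremised_fails :
    ¬ ∀ d : (ℝ × ℝ × ℝ × ℝ) × Set (ℝ × ℝ), ModelConsistentOn d.2 d.1.1 d.1.2.1 d.1.2.2.1 d.1.2.2.2 :=
  fun h => firstOrder_premise_loadBearing (h ((-1, 0, 0, 0), Set.univ))

/-- C4 (II-CS): a CS-edge member — the corner datum `D₀ = J₀ = X₀ = 1` (`D₀J₀ = X₀²`), any first-order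
coefficients. [cite: Zhang2022LandauSiegel, §2 (2.18)–(2.20), (2.32)–(2.33)] -/
theorem kbell_csEdge (D₁ J₁ X₁ : ℝ) : KBell (.csEdge ⟨1, D₁, 1, J₁, 1, X₁⟩) := by
  change (1 : ℝ) * 1 = 1 ^ 2
  norm_num

/-- C3 (II-CS) — premise INHABITED: the flat datum `D = J = X ≡ 1` (all first-order coefficients and remainders
`0`) satisfies `CSExactExpansion` (`1 ≤ 1` at every `A`). [cite: Zhang2022LandauSiegel, §2 (2.18)–(2.20), (2.32)–(2.33)] -/
theorem csEdge_premise_inhabited : CSExactExpansion ⟨1, 0, 1, 0, 1, 0⟩ := by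
  refine ⟨1, 0, fun _ => 0, fun _ => 0, fun _ => 0, one_pos, fun A _ => ?_, fun A _ => ?_⟩ <;> norm_num

/-- C3 (II-CS) — premise LOAD-BEARING: WITHOUT it the verdict shape fails — the member `D₀ = J₀ = X₀ = 1`,
`D₁ = J₁ = 0`, `X₁ = 1` has first-order CS margin `−2 < 0`. [cite: Zhang2022LandauSiegel, §2 (2.18)–(2.20), (2.32)–(2.33)] -/
theorem csEdge_unpremised_fails :
    ¬ ∀ d : CSEdgeDesign, familyBellCSEdge.InClass d → 0 ≤ d.D₀ * d.J₁ + d.D₁ * d.J₀ - 2 * d.X₀ * d.X₁ := by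
  intro h
  have := h ⟨1, 0, 1, 0, 1, 1⟩ (by change (1 : ℝ) * 1 = 1 ^ 2; norm_num)
  norm_num at this

/-- C4 (III′): a subcritical member exists at any scale record with `t₀ > 0`, `D > 4π²` and any `p` with
`p√D·t₀ > 1`. [cite: Zhang2022LandauSiegel, §2 (2.10), (2.30)] -/
theorem kbell_subcritical {S : Scales} {p : ℝ} (hp : 0 < p) (ht : 0 < S.t0) (hD : 4 * π ^ 2 < (S.D : ℝ))
    (hbig : 1 < p * Real.sqrt S.D * S.t0) : KBell (.subcritical S p) :=
  ⟨hp, ht, hD, hbig⟩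

/-- C4: `familyBell` is inhabited in every constructor (given a one-piece profile and a subcritical record).
[cite: Zhang2022LandauSiegel, §2 (2.32)] -/
theorem kbell_inhabited (l₁ : ℝ) :
    KBell (.onePiece (expComb k123 ![1, 0, -1]) (expComb' k123 ![1, 0, -1])) ∧ KBell (.k0Plane 1 (-1) 0 l₁) ∧
      KBell (.firstOrder (0, k0G₀ 1 (-1) 0, k0G₁ 1 (-1), k0G₂ 1 (-1)) (k0Model 0 l₁)) := by
  refine ⟨kbell_onePiece_expComb k123 (by simp [Fin.sum_univ_three]), ?_, trivial⟩
  change (0 : ℝ) ≤ 0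
  exact le_rfl

end Repair

end Literature.NumberTheory.LFunctions.Zhang2022

end
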